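import Mathlib
import Summits.AtomisticToContinuum.HydrodynamicLimit.Theorems.ImplosionDichotomyDenseExcursionPackingAnalyticSourcesBound

/-!
# The sources of the hierarchy of `Γ` in the COMPLEX domain: the pointwise majorant bound on the sonic triangle
# (crux `DenseExcursion`, stmt-AtomisticToContinuum-12586, line `sonic-cavity-renewal` v9, stub `stub_analyticPackingImplosion`)

Helper file (`--supports stmt-AtomisticToContinuum-12586`, line lead a2, wave-5 worker D2, task `packingSources_holomorphic`
(quantitative half), worker report `work/stubs/D2_triangle.REPORT.md` §4 (R1)). The complex twin of `packingSources_bound`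
(`…PackingAnalyticSourcesBound`, wave-3 worker D): at a point `z` of the sonic triangle, the complexified order-`k` sources
(verbatim the right-hand sides of `packingHierarchy_order` with holomorphic `wc i, sc i : ℂ → ℂ`, complex derivatives and
`Complex.exp (3z)`; stiffening coefficients in the closed form of `familyCoeff_stiffening` with the REAL jet `m`) obey THE SAME
majorant polynomial bound, with `|·| ↦ ‖·‖`:

* `packingSources_holomorphic_bound` (REGISTERED helper): with `S = sc 0 z ≠ 0`, `σ₁ ≥ ‖S′/S‖`, `σ₂ ≥ ‖S(S′+S)‖`,
  `Φ ≥ ‖e^{3z}S³‖` and `T_i ≥ ‖wc i‖ + ‖wc i′‖ + ‖sc i‖/‖S‖ + (1 + ‖S‖²)‖(sc i/S)′‖` (`1 ≤ i < k`, `T₀ = 0`, `T ≥ 0`):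
  `‖Src_w‖ + ‖Src_s‖/‖S‖ ≤ (9 + 3σ₂ + σ₁)[Gᵏ]T² + 3(1+σ₂) Σ_{p<k} [Gᵖ](1+T)² Σ_{j≤k−p} |m_j| Φʲ [G^{k−p−j}](1+T)^{3j}` — so
  `majorant_shift` applies verbatim on the triangle (where `‖S‖, ‖1/S‖ = O(1)`, so these weighted densities are equivalent to
  the sup-norm densities delivered by `sonicWindow_analytic_bound` + `triangle_cauchy_deriv`);
* tools: `norm_coeff_mk_pow_le`, `coeff_mk_const_mul_pow_complex`, `inner_sum_norm_le` (the `ℂ`-versions of the real tools).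

Pure algebra (adapted line by line from the real file). NOT here: holomorphy of the sources, their real trace, or `Γ`.
-/

noncomputable section

open Finset PowerSeries

namespace Summit.AtomisticToContinuum.HydrodynamicLimit.Theorems.PackingAnalyticImplosion

/-! ## Power-series tools over `ℂ` -/

-- adapted from `abs_coeff_mk_pow_le` (…PackingAnalyticSourcesBound)
/-- `‖[Gᵈ](Σ vₙ Gⁿ)ᴺ‖ ≤ [Gᵈ](Σ ‖vₙ‖ Gⁿ)ᴺ` for complex coefficients. [folklore] -/
theorem norm_coeff_mk_pow_le (v : ℕ → ℂ) :
    ∀ N d : ℕ, ‖coeff d ((PowerSeries.mk v) ^ N)‖ ≤ coeff d ((PowerSeries.mk fun n => ‖v n‖) ^ N) := by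
  intro N
  induction N with
  | zero =>
    intro d
    simp only [pow_zero, coeff_one]
    split_ifs <;> simp
  | succ N ih =>
    intro d
    rw [pow_succ, pow_succ, coeff_mul, coeff_mul]
    refine (norm_sum_le _ _).trans (sum_le_sum fun p _ => ?_)
    rw [norm_mul, coeff_mk, coeff_mk]
    exact mul_le_mul_of_nonneg_right (ih p.1) (norm_nonneg _)

-- adapted from `coeff_mk_const_mul_pow` (…PackingAnalyticSourcesBound)
/-- Homogeneity over `ℂ`: `[Gᵈ](Σ S vₙ Gⁿ)ᴺ = Sᴺ [Gᵈ](Σ vₙ Gⁿ)ᴺ`. [folklore] -/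
theorem coeff_mk_const_mul_pow_complex (S : ℂ) (v : ℕ → ℂ) (N d : ℕ) :
    coeff d ((PowerSeries.mk fun n => S * v n) ^ N) = S ^ N * coeff d ((PowerSeries.mk v) ^ N) := by
  have e : (PowerSeries.mk fun n => S * v n) = PowerSeries.C S * PowerSeries.mk v := by
    ext n; simp [coeff_C_mul]
  rw [e, mul_pow, ← map_pow, coeff_C_mul]

-- adapted from `inner_sum_le` (…PackingAnalyticSourcesBound)
/-- The inner (pressure) sums are dominated by `[Gᵖ] U²` (complex values, real majorants). [folklore] -/
theorem inner_sum_norm_le {F : ℕ → ℕ → ℂ} {U : ℕ → ℝ} {L : ℝ} {p : ℕ}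
    (h : ∀ i, i ≤ p → ‖F i (p - i)‖ ≤ L * U i * U (p - i)) :
    ‖∑ i ∈ range (p + 1), F i (p - i)‖ ≤ L * coeff p ((PowerSeries.mk U) ^ 2) := by
  rw [coeff_mk_sq, mul_sum]
  refine (norm_sum_le _ _).trans (sum_le_sum fun i hi => ?_)
  have := h i (Nat.lt_succ_iff.mp (mem_range.mp hi))
  linarith [this]

/-! ## The pointwise bound in the complex domain -/

set_option maxHeartbeats 800000 in -- one declaration: many small `nlinarith`/`gcongr` steps of one pointwise estimate
-- adapted from `packingSources_bound` (…PackingAnalyticSourcesBound): `|·| ↦ ‖·‖`, `x : ℝ ↦ z : ℂ`, `Real.exp ↦ Complex.exp`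
/-- **THE COMPLEX SOURCES, POINTWISE** (registered helper `packingSources_holomorphic_bound` of
`stub_analyticPackingImplosion`): the complexified order-`k` sources obey the majorant bound of `packingSources_bound` with
norms in place of absolute values. [folklore] -/
theorem packingSources_holomorphic_bound : ∀ (wc sc : ℕ → ℂ → ℂ) (m : ℕ → ℝ) (Mc : ℕ → ℂ → ℂ) (Sw Ss : ℂ → ℂ) (T : ℕ → ℝ) (k : ℕ) (z : ℂ) (σ₁ σ₂ Φ : ℝ), (∀ c, Mc c z = ∑ j ∈ Finset.range (c + 1), (m j : ℂ) * Complex.exp (3 * z) ^ j * PowerSeries.coeff (c - j) ((PowerSeries.mk fun n => sc n z) ^ (3 * j))) → (Sw z = (∑ i ∈ Finset.Ico 1 k, (wc i z * deriv (wc (k - i)) z + wc i z * wc (k - i) z + 3 * (sc i z * (deriv (sc (k - i)) z + sc (k - i) z)))) + 3 * ∑ p ∈ Finset.range k, (∑ i ∈ Finset.range (p + 1), sc i z * (deriv (sc (p - i)) z + sc (p - i) z)) * Mc (k - p) z) → (Ss z = ∑ i ∈ Finset.Ico 1 k, (wc i z * deriv (sc (k - i)) z + sc i z / 3 * deriv (wc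 (k - i)) z + 2 * (sc i z * wc (k - i) z))) → sc 0 z ≠ 0 → (∀ i, i < k → DifferentiableAt ℂ (sc i) z) → ‖deriv (sc 0) z / sc 0 z‖ ≤ σ₁ → ‖sc 0 z * (deriv (sc 0) z + sc 0 z)‖ ≤ σ₂ → ‖Complex.exp (3 * z) * sc 0 z ^ 3‖ ≤ Φ → T 0 = 0 → (∀ i, 0 ≤ T i) → (∀ i, 1 ≤ i → i < k → ‖wc i z‖ + ‖deriv (wc i) z‖ + ‖sc i z‖ / ‖sc 0 z‖ + (1 + ‖sc 0 z‖ ^ 2) * ‖deriv (fun y => sc i y / sc 0 y) z‖ ≤ T i) → ‖Sw z‖ + ‖Ss z‖ / ‖sc 0 z‖ ≤ (9 + 3 * σ₂ + σ₁) * PowerSeries.coeff k (PowerSeries.mk T ^ 2) + 3 * (1 + σ₂) * ∑ p ∈ Finset.range k, PowerSeries.coeff p ((1 + PowerSeries.mk T) ^ 2) * ∑ j ∈ Finset.range (k - p + 1), |m j| * Φ ^ j * PowerSeries.coeff (k - p - j) ((1 + PowerSeries.mk T) ^ (3 * j)) := by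
  intro wc sc m Mc Sw Ss T k z σ₁ σ₂ Φ hMc hSw hSs hS hdiff hσ₁ hσ₂ hΦ hT0 hTnn hT
  -- the trivial case `k = 0`
  rcases Nat.eq_zero_or_pos k with rfl | hk
  · simp only [Finset.range_zero, Finset.sum_empty, mul_zero, add_zero,
      Finset.Ico_eq_empty (by norm_num : ¬ (1:ℕ) < 0)] at hSw hSs
    rw [hSw, hSs]
    simp only [norm_zero, zero_div, add_zero, Finset.range_zero, Finset.sum_empty, mul_zero]
    have : 0 ≤ PowerSeries.coeff 0 (PowerSeries.mk T ^ 2) := by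
      rw [coeff_zero_mk_pow, hT0]; norm_num
    have hσ₁' : 0 ≤ σ₁ := (norm_nonneg _).trans hσ₁
    have hσ₂' : 0 ≤ σ₂ := (norm_nonneg _).trans hσ₂
    positivity
  -- notation at the point `z`
  set S : ℂ := sc 0 z with hSdef
  set S' : ℂ := deriv (sc 0) z with hS'def
  have hS0 : S ≠ 0 := hS
  have hSn : 0 < ‖S‖ := norm_pos_iff.2 hS0
  have hσ₁' : 0 ≤ σ₁ := (norm_nonneg _).trans hσ₁
  have hσ₂' : 0 ≤ σ₂ := (norm_nonneg _).trans hσ₂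
  have hΦ0 : 0 ≤ ‖Complex.exp (3 * z) * S ^ 3‖ := norm_nonneg _
  have hΦ' : 0 ≤ Φ := hΦ0.trans hΦ
  set v : ℕ → ℂ := fun i => sc i z / S with hvdef
  set v' : ℕ → ℂ := fun i => deriv (fun y => sc i y / sc 0 y) z with hv'def
  set U : ℕ → ℝ := fun n => if n = 0 then 1 else T n with hUdef
  have hU0 : U 0 = 1 := by simp [hUdef]
  have hUpos : ∀ n, 1 ≤ n → U n = T n := fun n hn => by simp [hUdef, show n ≠ 0 by omega]
  have hUnn : ∀ n, 0 ≤ U n := fun n => by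
    rcases Nat.eq_zero_or_pos n with rfl | hn
    · rw [hU0]; norm_num
    · rw [hUpos n hn]; exact hTnn n
  have eU : (1 + PowerSeries.mk T : PowerSeries ℝ) = PowerSeries.mk U := one_add_mk_eq hT0
  -- values and derivatives of the `s`-coefficients through `v`, `v'`
  have hv0 : v 0 = 1 := by
    show sc 0 z / S = 1
    rw [← hSdef]; exact div_self hS0
  have hsc : ∀ i, sc i z = S * v i := fun i => by simp only [hvdef]; field_simp
  have hdsc : ∀ i, i < k → deriv (sc i) z = S * v' i + S' * v i := by
    intro i hi
    have hd : deriv (fun y => sc i y / sc 0 y) z =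
        (deriv (sc i) z * sc 0 z - sc i z * deriv (sc 0) z) / sc 0 z ^ 2 :=
      ((hdiff i hi).hasDerivAt.div (hdiff 0 hk).hasDerivAt hS0).deriv
    rw [← hSdef, ← hS'def] at hd
    simp only [hv'def, hvdef]
    rw [hd]
    field_simp
    ring
  -- the bounds on the lower orders
  have hbw : ∀ i, 1 ≤ i → i < k → ‖wc i z‖ ≤ T i := fun i h1 h2 => by
    have := hT i h1 h2
    have h3 : 0 ≤ ‖sc i z‖ / ‖sc 0 z‖ := by positivity
    nlinarith [norm_nonneg (deriv (wc i) z), norm_nonneg (deriv (fun y => sc i y / sc 0 y) z), sq_nonneg ‖sc 0 z‖]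
  have hbw' : ∀ i, 1 ≤ i → i < k → ‖deriv (wc i) z‖ ≤ T i := fun i h1 h2 => by
    have := hT i h1 h2
    have h3 : 0 ≤ ‖sc i z‖ / ‖sc 0 z‖ := by positivity
    nlinarith [norm_nonneg (wc i z), norm_nonneg (deriv (fun y => sc i y / sc 0 y) z), sq_nonneg ‖sc 0 z‖]
  have hbv : ∀ i, 1 ≤ i → i < k → ‖v i‖ ≤ T i := fun i h1 h2 => by
    have := hT i h1 h2
    have e : ‖v i‖ = ‖sc i z‖ / ‖sc 0 z‖ := by rw [hvdef]; simp only; rw [norm_div]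
    rw [e]
    nlinarith [norm_nonneg (wc i z), norm_nonneg (deriv (wc i) z), norm_nonneg (deriv (fun y => sc i y / sc 0 y) z),
      sq_nonneg ‖sc 0 z‖]
  have hbv' : ∀ i, 1 ≤ i → i < k → ‖v' i‖ ≤ T i ∧ ‖S ^ 2 * v' i‖ ≤ T i := fun i h1 h2 => by
    have := hT i h1 h2
    have h3 : 0 ≤ ‖sc i z‖ / ‖sc 0 z‖ := by positivity
    have h4 : ‖S ^ 2 * v' i‖ = ‖S‖ ^ 2 * ‖v' i‖ := by rw [norm_mul, norm_pow]
    simp only [hv'def] at h4 ⊢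
    rw [h4]
    constructor <;> nlinarith [norm_nonneg (wc i z), norm_nonneg (deriv (wc i) z),
      norm_nonneg (deriv (fun y => sc i y / sc 0 y) z), sq_nonneg ‖sc 0 z‖]
  have hvU : ∀ i, i < k → ‖v i‖ ≤ U i := fun i hi => by
    rcases Nat.eq_zero_or_pos i with rfl | h1
    · rw [hv0, hU0, norm_one]
    · rw [hUpos i h1]; exact hbv i h1 hi
  -- THE PRESSURE MONOMIALS: `‖sc i (sc j′ + sc j)‖ ≤ (1 + σ₂) U_i U_j`
  have hP : ∀ i j, i < k → j < k → ‖sc i z * (deriv (sc j) z + sc j z)‖ ≤ (1 + σ₂) * U i * U j := by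
    intro i j hi hj
    have hσ₂S : ‖S * (S' + S)‖ ≤ σ₂ := hσ₂
    rcases Nat.eq_zero_or_pos j with rfl | hj1
    · have e : sc i z * (deriv (sc 0) z + sc 0 z) = v i * (S * (S' + S)) := by rw [hsc i]; ring
      rw [e, norm_mul, hU0, mul_one]
      calc ‖v i‖ * ‖S * (S' + S)‖ ≤ U i * σ₂ := mul_le_mul (hvU i hi) hσ₂S (norm_nonneg _) (hUnn i)
        _ ≤ (1 + σ₂) * U i := by nlinarith [hUnn i]
    · have e : sc i z * (deriv (sc j) z + sc j z) = v i * (S ^ 2 * v' j) + v i * v j * (S * (S' + S)) := by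
        rw [hsc i, hdsc j hj, hsc j]; ring
      rw [e, hUpos j hj1]
      obtain ⟨-, h2⟩ := hbv' j hj1 hj
      calc ‖v i * (S ^ 2 * v' j) + v i * v j * (S * (S' + S))‖
          ≤ ‖v i * (S ^ 2 * v' j)‖ + ‖v i * v j * (S * (S' + S))‖ := norm_add_le _ _
        _ = ‖v i‖ * ‖S ^ 2 * v' j‖ + ‖v i‖ * ‖v j‖ * ‖S * (S' + S)‖ := by
            rw [norm_mul (v i) (S ^ 2 * v' j), norm_mul (v i * v j), norm_mul (v i) (v j)]
        _ ≤ U i * T j + U i * T j * σ₂ := by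
            gcongr
            · exact hUnn i
            · exact hvU i hi
            · exact mul_nonneg (hUnn i) (hTnn j)
            · exact hUnn i
            · exact hvU i hi
            · exact hbv j hj1 hj
        _ = (1 + σ₂) * U i * T j := by ring
  -- the inner sums
  have hinner : ∀ p, p < k → ‖∑ i ∈ range (p + 1), sc i z * (deriv (sc (p - i)) z + sc (p - i) z)‖ ≤
      (1 + σ₂) * coeff p ((PowerSeries.mk U) ^ 2) := fun p hp =>
    inner_sum_norm_le (F := fun i j => sc i z * (deriv (sc j) z + sc j z)) fun i hi => hP i (p - i) (by omega) (by omega)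
  -- the stiffening coefficients
  have hMcb : ∀ c, 1 ≤ c → c ≤ k → ‖Mc c z‖ ≤ ∑ j ∈ range (c + 1), |m j| * Φ ^ j *
      coeff (c - j) ((PowerSeries.mk U) ^ (3 * j)) := by
    intro c hc1 hck
    rw [hMc c]
    refine (norm_sum_le _ _).trans (sum_le_sum fun j hj => ?_)
    have hjc : j ≤ c := Nat.lt_succ_iff.mp (mem_range.mp hj)
    have emk : (PowerSeries.mk fun n => sc n z) = PowerSeries.mk fun n => S * v n := by
      ext n; simp [coeff_mk, hsc n]
    have e1 : ‖(m j : ℂ) * Complex.exp (3 * z) ^ j * coeff (c - j) ((PowerSeries.mk fun n => sc n z) ^ (3 * j))‖ =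
        |m j| * ‖Complex.exp (3 * z) * S ^ 3‖ ^ j * ‖coeff (c - j) ((PowerSeries.mk v) ^ (3 * j))‖ := by
      rw [emk, coeff_mk_const_mul_pow_complex, norm_mul, norm_mul, norm_mul, Complex.norm_real, Real.norm_eq_abs,
        norm_pow, norm_pow, norm_mul, norm_pow, pow_mul, mul_pow]
      ring
    rw [e1]
    have h1 : ‖Complex.exp (3 * z) * S ^ 3‖ ^ j ≤ Φ ^ j := pow_le_pow_left₀ hΦ0 hΦ j
    have h2 : ‖coeff (c - j) ((PowerSeries.mk v) ^ (3 * j))‖ ≤ coeff (c - j) ((PowerSeries.mk U) ^ (3 * j)) := by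
      rcases Nat.eq_zero_or_pos j with rfl | hj1
      · simp only [mul_zero, pow_zero, coeff_one]
        split_ifs <;> simp
      · refine (norm_coeff_mk_pow_le v (3 * j) (c - j)).trans ?_
        have hmono := coeff_pow_mono (t := fun n => ‖v n‖) (c := U) (j := c - j)
          (fun n hn => ⟨norm_nonneg _, hvU n (by omega)⟩) (3 * j) (c - j) le_rfl
        exact hmono.2
    have h3 : 0 ≤ coeff (c - j) ((PowerSeries.mk U) ^ (3 * j)) :=
      (coeff_pow_mono (t := U) (c := U) (j := c - j) (fun n _ => ⟨hUnn n, le_rfl⟩) (3 * j) (c - j) le_rfl).1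
    have h4 : 0 ≤ |m j| := abs_nonneg _
    exact mul_le_mul (mul_le_mul_of_nonneg_left h1 h4) h2 (norm_nonneg _) (mul_nonneg h4 (pow_nonneg hΦ' _))
  -- the quadratic sums are dominated by `[Gᵏ] T²`
  have hquad : ∑ i ∈ Ico 1 k, T i * T (k - i) ≤ coeff k ((PowerSeries.mk T) ^ 2) := by
    rw [coeff_mk_sq]
    refine sum_le_sum_of_subset_of_nonneg (fun i hi => ?_) fun i _ _ => mul_nonneg (hTnn _) (hTnn _)
    rw [mem_Ico] at hi; rw [mem_range]; omega
  have hquad0 : 0 ≤ coeff k ((PowerSeries.mk T) ^ 2) :=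
    (sum_nonneg fun i _ => mul_nonneg (hTnn i) (hTnn (k - i))).trans hquad
  have h3n : ‖(3 : ℂ)‖ = 3 := by norm_num
  -- the `w`-source
  have hW : ‖Sw z‖ ≤ (5 + 3 * σ₂) * coeff k ((PowerSeries.mk T) ^ 2) + 3 * (1 + σ₂) * ∑ p ∈ range k,
      coeff p ((PowerSeries.mk U) ^ 2) * ∑ j ∈ range (k - p + 1), |m j| * Φ ^ j *
        coeff (k - p - j) ((PowerSeries.mk U) ^ (3 * j)) := by
    rw [hSw]
    refine (norm_add_le _ _).trans (add_le_add ?_ ?_)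
    · refine (norm_sum_le _ _).trans ?_
      calc ∑ i ∈ Ico 1 k, ‖wc i z * deriv (wc (k - i)) z + wc i z * wc (k - i) z +
              3 * (sc i z * (deriv (sc (k - i)) z + sc (k - i) z))‖
          ≤ ∑ i ∈ Ico 1 k, (5 + 3 * σ₂) * (T i * T (k - i)) := by
            refine sum_le_sum fun i hi => ?_
            obtain ⟨hi1, hik⟩ := mem_Ico.mp hi
            have hki1 : 1 ≤ k - i := by omega
            have hkik : k - i < k := by omega
            have h1 : ‖wc i z * deriv (wc (k - i)) z‖ ≤ T i * T (k - i) := by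
              rw [norm_mul]; exact mul_le_mul (hbw i hi1 hik) (hbw' _ hki1 hkik) (norm_nonneg _) (hTnn _)
            have h2 : ‖wc i z * wc (k - i) z‖ ≤ T i * T (k - i) := by
              rw [norm_mul]; exact mul_le_mul (hbw i hi1 hik) (hbw _ hki1 hkik) (norm_nonneg _) (hTnn _)
            have h3 : ‖3 * (sc i z * (deriv (sc (k - i)) z + sc (k - i) z))‖ ≤ 3 * ((1 + σ₂) * T i * T (k - i)) := by
              rw [norm_mul, h3n]
              have := hP i (k - i) hik hkik
              rw [hUpos i hi1, hUpos (k - i) hki1] at this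
              linarith
            calc _ ≤ ‖wc i z * deriv (wc (k - i)) z + wc i z * wc (k - i) z‖ +
                  ‖3 * (sc i z * (deriv (sc (k - i)) z + sc (k - i) z))‖ := norm_add_le _ _
              _ ≤ (‖wc i z * deriv (wc (k - i)) z‖ + ‖wc i z * wc (k - i) z‖) +
                  ‖3 * (sc i z * (deriv (sc (k - i)) z + sc (k - i) z))‖ := by gcongr; exact norm_add_le _ _
              _ ≤ (T i * T (k - i) + T i * T (k - i)) + 3 * ((1 + σ₂) * T i * T (k - i)) := by gcongr
              _ = (5 + 3 * σ₂) * (T i * T (k - i)) := by ring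
        _ = (5 + 3 * σ₂) * ∑ i ∈ Ico 1 k, T i * T (k - i) := by rw [mul_sum]
        _ ≤ (5 + 3 * σ₂) * coeff k ((PowerSeries.mk T) ^ 2) := mul_le_mul_of_nonneg_left hquad (by linarith)
    · rw [norm_mul, h3n, mul_assoc, mul_sum]
      refine mul_le_mul_of_nonneg_left ((norm_sum_le _ _).trans (sum_le_sum fun p hp => ?_)) (by norm_num)
      have hp' : p < k := mem_range.mp hp
      rw [norm_mul]
      have h1 := hinner p hp'
      have h2 := hMcb (k - p) (by omega) (by omega)
      have h3 : 0 ≤ ∑ j ∈ range (k - p + 1), |m j| * Φ ^ j * coeff (k - p - j) ((PowerSeries.mk U) ^ (3 * j)) :=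
        sum_nonneg fun j _ => mul_nonneg (mul_nonneg (abs_nonneg _) (pow_nonneg hΦ' _))
          (coeff_pow_mono (t := U) (c := U) (j := k - p - j) (fun n _ => ⟨hUnn n, le_rfl⟩) (3 * j) _ le_rfl).1
      calc ‖∑ i ∈ range (p + 1), sc i z * (deriv (sc (p - i)) z + sc (p - i) z)‖ * ‖Mc (k - p) z‖
          ≤ ((1 + σ₂) * coeff p ((PowerSeries.mk U) ^ 2)) *
              ∑ j ∈ range (k - p + 1), |m j| * Φ ^ j * coeff (k - p - j) ((PowerSeries.mk U) ^ (3 * j)) :=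
            mul_le_mul h1 h2 (norm_nonneg _) (by
              have : 0 ≤ coeff p ((PowerSeries.mk U) ^ 2) :=
                (coeff_pow_mono (t := U) (c := U) (j := p) (fun n _ => ⟨hUnn n, le_rfl⟩) 2 p le_rfl).1
              positivity)
        _ = (1 + σ₂) * (coeff p ((PowerSeries.mk U) ^ 2) *
              ∑ j ∈ range (k - p + 1), |m j| * Φ ^ j * coeff (k - p - j) ((PowerSeries.mk U) ^ (3 * j))) := by ring
  -- the `s`-source over `‖S‖`
  have hSb : ‖Ss z‖ / ‖sc 0 z‖ ≤ (4 + σ₁) * coeff k ((PowerSeries.mk T) ^ 2) := by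
    rw [← hSdef, ← norm_div, hSs, sum_div]
    refine (norm_sum_le _ _).trans ?_
    calc ∑ i ∈ Ico 1 k, ‖(wc i z * deriv (sc (k - i)) z + sc i z / 3 * deriv (wc (k - i)) z +
            2 * (sc i z * wc (k - i) z)) / S‖
        ≤ ∑ i ∈ Ico 1 k, (4 + σ₁) * (T i * T (k - i)) := by
          refine sum_le_sum fun i hi => ?_
          obtain ⟨hi1, hik⟩ := mem_Ico.mp hi
          have hki1 : 1 ≤ k - i := by omega
          have hkik : k - i < k := by omega
          have e : (wc i z * deriv (sc (k - i)) z + sc i z / 3 * deriv (wc (k - i)) z + 2 * (sc i z * wc (k - i) z)) / S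
              = wc i z * v' (k - i) + wc i z * (S' / S) * v (k - i) + 1 / 3 * (v i * deriv (wc (k - i)) z) +
                2 * (v i * wc (k - i) z) := by
            rw [hdsc (k - i) hkik, hsc i]; field_simp
          rw [e]
          have hσ : ‖S' / S‖ ≤ σ₁ := hσ₁
          have h1 : ‖wc i z * v' (k - i)‖ ≤ T i * T (k - i) := by
            rw [norm_mul]; exact mul_le_mul (hbw i hi1 hik) (hbv' _ hki1 hkik).1 (norm_nonneg _) (hTnn _)
          have h2 : ‖wc i z * (S' / S) * v (k - i)‖ ≤ T i * σ₁ * T (k - i) := by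
            rw [norm_mul, norm_mul]
            exact mul_le_mul (mul_le_mul (hbw i hi1 hik) hσ (norm_nonneg _) (hTnn _)) (hbv _ hki1 hkik)
              (norm_nonneg _) (mul_nonneg (hTnn _) hσ₁')
          have h13 : ‖(1 / 3 : ℂ)‖ = 1 / 3 := by norm_num
          have h2n : ‖(2 : ℂ)‖ = 2 := by norm_num
          have h3 : ‖1 / 3 * (v i * deriv (wc (k - i)) z)‖ ≤ 1 / 3 * (T i * T (k - i)) := by
            rw [norm_mul, h13, norm_mul]
            exact mul_le_mul_of_nonneg_left (mul_le_mul (hbv i hi1 hik) (hbw' _ hki1 hkik) (norm_nonneg _) (hTnn _))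
              (by norm_num)
          have h4 : ‖2 * (v i * wc (k - i) z)‖ ≤ 2 * (T i * T (k - i)) := by
            rw [norm_mul, h2n, norm_mul]
            exact mul_le_mul_of_nonneg_left (mul_le_mul (hbv i hi1 hik) (hbw _ hki1 hkik) (norm_nonneg _) (hTnn _))
              (by norm_num)
          have hTT : 0 ≤ T i * T (k - i) := mul_nonneg (hTnn _) (hTnn _)
          calc _ ≤ ‖wc i z * v' (k - i) + wc i z * (S' / S) * v (k - i) + 1 / 3 * (v i * deriv (wc (k - i)) z)‖ +
                ‖2 * (v i * wc (k - i) z)‖ := norm_add_le _ _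
            _ ≤ (‖wc i z * v' (k - i) + wc i z * (S' / S) * v (k - i)‖ + ‖1 / 3 * (v i * deriv (wc (k - i)) z)‖) +
                ‖2 * (v i * wc (k - i) z)‖ := by gcongr; exact norm_add_le _ _
            _ ≤ ((‖wc i z * v' (k - i)‖ + ‖wc i z * (S' / S) * v (k - i)‖) + ‖1 / 3 * (v i * deriv (wc (k - i)) z)‖) +
                ‖2 * (v i * wc (k - i) z)‖ := by gcongr; exact norm_add_le _ _
            _ ≤ ((T i * T (k - i) + T i * σ₁ * T (k - i)) + 1 / 3 * (T i * T (k - i))) + 2 * (T i * T (k - i)) := by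
                gcongr
            _ ≤ (4 + σ₁) * (T i * T (k - i)) := by nlinarith
      _ = (4 + σ₁) * ∑ i ∈ Ico 1 k, T i * T (k - i) := by rw [mul_sum]
      _ ≤ (4 + σ₁) * coeff k ((PowerSeries.mk T) ^ 2) := mul_le_mul_of_nonneg_left hquad (by linarith)
  -- assemble
  rw [eU]
  have hsum0 : 0 ≤ ∑ p ∈ range k, coeff p ((PowerSeries.mk U) ^ 2) * ∑ j ∈ range (k - p + 1), |m j| * Φ ^ j *
      coeff (k - p - j) ((PowerSeries.mk U) ^ (3 * j)) :=
    sum_nonneg fun p _ => mul_nonneg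
      (coeff_pow_mono (t := U) (c := U) (j := p) (fun n _ => ⟨hUnn n, le_rfl⟩) 2 p le_rfl).1
      (sum_nonneg fun j _ => mul_nonneg (mul_nonneg (abs_nonneg _) (pow_nonneg hΦ' _))
        (coeff_pow_mono (t := U) (c := U) (j := k - p - j) (fun n _ => ⟨hUnn n, le_rfl⟩) (3 * j) _ le_rfl).1)
  linarith [hW, hSb]

end Summit.AtomisticToContinuum.HydrodynamicLimit.Theorems.PackingAnalyticImplosion

end
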